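import Literature.AlgebraicGeometry.ModuliOfAbelianVarieties.SiegelAdelicMarkingIsogenyQuotient
import HarnessLib

/-!
# Homomorphisms between marked abelian varieties reading a rational matrix: KERNEL LAWS
# ([Milne 2005] Thm. 6.11 «`η : V(𝔸_f) → V_f(A)`», p. 75 «`V/Λ ≅ V(𝔸_f)/Λ̂`»; [Mumford 1970] §7 Thm. 4, §19 Remark)

Topic `AlgebraicGeometry/ModuliOfAbelianVarieties`; namespace `Literature.AlgebraicGeometry.ModuliOfAbelianVarieties.SiegelAdelicMarking`.
THEOREMS ONLY (no definition, no named fact, no instance, no notation, no `sorry`).  Cell `hodgecm-mathlib`, half A line L5 → «M-67» X-LEAF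
`Lines/F0_P6a_EExports.lean` socket `stub_EHECKE` (Hecke roofs of the E-witness at COMPLEX points), organ **(O-H) «MARKED HOM FAMILY WITH KERNEL
LAWS»** (LA5-plan (g3) DEAL L5-#1, 2026-09-02): the marking-level half of the (r1)∕(r2) kernel clauses of `RoofE` and of the `H_β = K_β ∩ A[𝔭]`,
`Nat.card H_β = p^f` clauses of `HeckeRoofsE` (E-READINGS `Cruxes/HLiu418/Lines/F0_P6a_EReadings.lean`).  Sequel of ★ `SiegelAdelicMarkingHoms`
(GAGA: a `J`-linear lattice-compatible rational `q` IS a homomorphism `h` with `h(u v) = u′(q v)`) and ★ `SiegelAdelicMarkingIsogenyQuotient` (such an `h`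
with `q` invertible is onto on `ℂ`-points).  HC_CM is proved only modulo the 7 printed citations until rung 0 closes; this file discharges none of them
(generic, moduli-free capital).

## Setting
`m : SiegelAdelicMarking J a A`, `m′ : SiegelAdelicMarking J′ a′ A′` (★ carrier: uniformisations `(V_ℝ, J)/Λ_a ≅ A(ℂ)` with torsion parametrisations
`u = m.r : V = ℚ^{2g} → A(ℂ)`, `ker u = Λ_a`, ★ `r_eq_one_iff_mem_latticeOfGL`), and a homomorphism `h : A ⟶ A′` READING an invertible rational matrix
`q`: `h (u v) = u′ (q v)` for all `v ∈ V` (the output shape of ★ `exists_hom_forall_map_r_eq`).  Write `q⁻¹Λ_{a′}` for the `ℤ`-submodule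
`(latticeOfGL a′).comap q` of `V` and `[L : Λ_a]` for Mathlib՚s `(latticeOfGL a).toAddSubgroup.relIndex L.toAddSubgroup`.

## What is proved
* §1 (marking level, no `h`): `mem_image_r_iff` — for a `ℤ`-submodule `L ⊇ Λ_a`, `u v ∈ u(L) ↔ v ∈ L`;
  **`natCard_image_r_eq_relIndex`** — `Nat.card u(L) = [L : Λ_a]` for EVERY `ℤ`-submodule `L` of `V` (`u(L) ≅ L ⁄ (L ∩ Λ_a)`, Mathlib `AddSubgroup.relIndex_ker`);
  `map_mem_image_r_of_forall_mulVec_mem` — an endomorphism reading a rational matrix `M` with `M L ⊆ L` preserves `u(L)`.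
* §2 (L) `mulVec_mem_latticeOfGL_of_forall_map_r_eq` — the reading alone forces `q Λ_a ⊆ Λ_{a′}`; `isIsogeny_of_forall_map_r_eq` — `h` is an isogeny;
  (K) **`map_eq_one_iff_of_forall_map_r_eq`** — `h P = 1 ↔ ∃ v, u v = P ∧ q v ∈ Λ_{a′}`; `coe_kerPoints_eq_image_r` — `Ker h (ℂ) = u (q⁻¹Λ_{a′})` as sets;
  (C) **`natCard_kerPoints_eq_relIndex`** — `Nat.card (Ker h (ℂ)) = [q⁻¹Λ_{a′} : Λ_a]`.
* §3 (U) `forall_map_comp_r_eq` (a composite reads the product matrix), `forall_map_id_r_eq`, `eq_of_forall_map_r_eq` (two homomorphisms reading the same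
  matrix are equal, ★ `hom_eq_of_forall_map_r_eq`), `comp_eq_comp_of_mul_eq_mul` (squares of readings commute when the matrices do).
* §5 (ED. 2) FAMILIES `h_i : A ⟶ A′` (`i ∈ S`, one reading an invertible matrix) with endomorphisms `ι b` (`b ∈ 𝔞`): **`forall_map_eq_one_and_forall_iff`**,
  `setOf_forall_map_eq_one_and_forall_eq_image_r`, **`natCard_forall_map_eq_one_and_forall_eq_relIndex`** (`⋂ Ker h_i ∩ A[𝔞] = u(⨅ q_i⁻¹Λ_{a′} ⊓ ⨅ (M b)⁻¹Λ_a)` and its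
  cardinality as a relative index; `𝒪_F`-stability of that set then follows from §1 `map_mem_image_r_of_forall_mulVec_mem`).
* §4 (T) for a family of endomorphisms `ι b`, `b ∈ 𝔞`, reading matrices `M b` on ONE marking: **`map_eq_one_and_forall_iff`** —
  `h P = 1 ∧ (∀ b ∈ 𝔞, ι b P = 1) ↔ ∃ v, u v = P ∧ q v ∈ Λ_{a′} ∧ ∀ b ∈ 𝔞, M b v ∈ Λ_a`; `setOf_map_eq_one_and_forall_eq_image_r` (that set is
  `u (q⁻¹Λ_{a′} ⊓ ⨅_{b ∈ 𝔞} (M b)⁻¹Λ_a)`) and **`natCard_map_eq_one_and_forall_eq_relIndex`** (its cardinality is the lattice index).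

## References
* [Milne2005ShimuraVarieties] J. S. Milne, *Introduction to Shimura varieties* (2005), §6 Thm. 6.11 p. 74 and p. 75; §4 pp. 48–49.
* [MumfordAV1970] D. Mumford, *Abelian Varieties* (1970), §7 Thm. 4 (p. 72), §19 Remark (p. 172) and Thm. 3 with Cor. 1.
* [Deligne1971TravauxShimura] P. Deligne, *Travaux de Shimura*, Sém. Bourbaki 389 (1971), 4.11–4.12 pp. 148–149.

#harness_tags algebraic_geometry.abelian_varieties, number_theory.shimura_varieties
-/

set_option autoImplicit false

noncomputable section

open CategoryTheory AlgebraicGeometry Matrix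
open Literature.AlgebraicGeometry.Motives (SchemeOver ComplexPoints AlgPoints specOver AbelianVariety)
open Literature.NumberTheory.Adeles (latticeOfGL)

namespace Literature.AlgebraicGeometry.ModuliOfAbelianVarieties

namespace SiegelAdelicMarking

open Literature.AlgebraicGeometry.Motives.AbelianVariety (IsIsogeny)
open Literature.AlgebraicGeometry.Motives.AbelianVariety.Hom (kerPoints mem_kerPoints_iff)

variable {g : ℕ} {δ : Fin g → ℕ} {J J' J'' : C0pm δ} {a a' a'' : gspFinAdelic δ} {A A' A'' : AbelianVariety ℂ}

/-! ### §0 Two point-level conveniences -/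

/-- A homomorphism of abelian varieties sends the unit point to the unit point (the induced map on `A(L) = Hom(Spec L, A)` is a group
homomorphism, Mathlib `IsMonHom.monoidHom`). [folklore] -/
private theorem map_hom_one {B B' : AbelianVariety ℂ} (χ : B ⟶ B') : AlgPoints.map χ.hom.hom.hom (1 : B.Points ℂ) = 1 := by
  have h := map_one (IsMonHom.monoidHom χ.hom.hom.hom (specOver ℂ ℂ))
  simpa only [IsMonHom.monoidHom_apply, AlgPoints.map_apply] using h

/-- `u v = u w ↔ v − w ∈ Λ_a`, membership form in a `ℤ`-submodule containing `Λ_a`: if `u v = u w` and `w ∈ L ⊇ Λ_a` then `v ∈ L`. [cite: Milne2005ShimuraVarieties, §6 Thm. 6.11 p. 74 and p. 75] -/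
theorem mem_of_r_eq_r_of_mem (m : SiegelAdelicMarking J a A) {L : Submodule ℤ (Fin g ⊕ Fin g → ℚ)}
    (hL : latticeOfGL (a : GL (Fin g ⊕ Fin g) finAdeleQ) ≤ L) {v w : Fin g ⊕ Fin g → ℚ} (hvw : m.r v = m.r w) (hw : w ∈ L) :
    v ∈ L := by
  have h1 : v - w ∈ L := hL ((m.r_eq_r_iff_sub_mem_latticeOfGL v w).1 hvw)
  have h2 : v - w + w ∈ L := L.add_mem h1 hw
  rwa [sub_add_cancel] at h2

/-! ### §1 Marking level: the image `u(L)` of a `ℤ`-submodule `L ⊆ V` and its cardinality `[L : Λ_a]` -/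

/-- **`u v ∈ u(L) ↔ v ∈ L`** for a `ℤ`-submodule `L ⊇ Λ_a = ker u`. [cite: Milne2005ShimuraVarieties, §6 Thm. 6.11 p. 74 and p. 75] -/
theorem mem_image_r_iff (m : SiegelAdelicMarking J a A) {L : Submodule ℤ (Fin g ⊕ Fin g → ℚ)}
    (hL : latticeOfGL (a : GL (Fin g ⊕ Fin g) finAdeleQ) ≤ L) (v : Fin g ⊕ Fin g → ℚ) :
    m.r v ∈ m.r '' (L : Set (Fin g ⊕ Fin g → ℚ)) ↔ v ∈ L := by
  constructor
  · rintro ⟨w, hw, hvw⟩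
    exact m.mem_of_r_eq_r_of_mem hL hvw.symm hw
  · exact fun hv => ⟨v, hv, rfl⟩

/-- **`Nat.card u(L) = [L : Λ_a]`** for every `ℤ`-submodule `L` of `V = ℚ^{2g}`: `u|_L` is a homomorphism onto `u(L)` with kernel `L ∩ Λ_a`, so
`u(L) ≅ L ⁄ (L ∩ Λ_a)` whose cardinality is Mathlib՚s relative index `(latticeOfGL a).toAddSubgroup.relIndex L.toAddSubgroup` (`0` when infinite)
(«`V/Λ ≅ V(𝔸_f)/Λ̂`»; Mathlib `AddSubgroup.relIndex_ker`). [cite: Milne2005ShimuraVarieties, §6 Thm. 6.11 p. 74 and p. 75] -/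
theorem natCard_image_r_eq_relIndex (m : SiegelAdelicMarking J a A) (L : Submodule ℤ (Fin g ⊕ Fin g → ℚ)) :
    Nat.card ↥(m.r '' (L : Set (Fin g ⊕ Fin g → ℚ))) =
      (latticeOfGL (a : GL (Fin g ⊕ Fin g) finAdeleQ)).toAddSubgroup.relIndex L.toAddSubgroup := by
  -- the torsion parametrisation as an additive homomorphism `u : V →+ A(ℂ)` (target written additively)
  let f : (Fin g ⊕ Fin g → ℚ) →+ Additive (A.Points ℂ) :=
    { toFun := fun v => Additive.ofMul (m.r v)
      map_zero' := by rw [m.r_zero]; rfl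
      map_add' := fun v w => by rw [m.r_add]; rfl }
  -- `ker u = Λ_a`
  have hker : f.ker = (latticeOfGL (a : GL (Fin g ⊕ Fin g) finAdeleQ)).toAddSubgroup := by
    ext v
    rw [AddMonoidHom.mem_ker, Submodule.mem_toAddSubgroup, ← m.r_eq_one_iff_mem_latticeOfGL]
    exact Additive.ofMul.apply_eq_iff_eq_symm_apply
  rw [← hker, AddSubgroup.relIndex_ker]
  -- `u(L)` read additively is `L.map u`
  refine (Nat.card_congr (Equiv.subtypeEquiv Additive.toMul fun x => ?_)).symm
  rw [AddSubgroup.mem_map, Set.mem_image]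
  refine exists_congr fun y => ?_
  rw [Submodule.mem_toAddSubgroup, SetLike.mem_coe]
  exact and_congr_right fun _ => Additive.ofMul.apply_eq_iff_eq_symm_apply

/-- **An endomorphism reading a rational matrix `M` on the marking (`ι (u v) = u (M v)`) with `M L ⊆ L` preserves `u(L)`** (the `𝒪_F`-stability clause
`∀ a, ∀ P ∈ H_β, ι(a) P ∈ H_β` of the E-side Hecke roofs, lattice side). [cite: Milne2005ShimuraVarieties, §6 Thm. 6.11 p. 74] -/
theorem map_mem_image_r_of_forall_mulVec_mem (m : SiegelAdelicMarking J a A) {L : Submodule ℤ (Fin g ⊕ Fin g → ℚ)}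
    (ι : A ⟶ A) (M : Matrix (Fin g ⊕ Fin g) (Fin g ⊕ Fin g) ℚ)
    (hι : ∀ v : Fin g ⊕ Fin g → ℚ, AlgPoints.map ι.hom.hom.hom (m.r v) = m.r (M *ᵥ v))
    (hM : ∀ v ∈ L, M *ᵥ v ∈ L) {P : A.Points ℂ} (hP : P ∈ m.r '' (L : Set (Fin g ⊕ Fin g → ℚ))) :
    AlgPoints.map ι.hom.hom.hom P ∈ m.r '' (L : Set (Fin g ⊕ Fin g → ℚ)) := by
  obtain ⟨v, hv, rfl⟩ := hP
  exact ⟨M *ᵥ v, hM v hv, (hι v).symm⟩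

/-! ### §2 A homomorphism reading an invertible rational matrix: lattice inclusion, isogeny, kernel, kernel count -/

/-- (L) **The reading forces `q Λ_a ⊆ Λ_{a′}`**: `u′ (q v) = h (u v) = h 1 = 1` for `v ∈ Λ_a` (any rational `q`, invertible or not).
[cite: Milne2005ShimuraVarieties, §6 Thm. 6.11 p. 74 and p. 75] -/
theorem mulVec_mem_latticeOfGL_of_forall_map_r_eq (m : SiegelAdelicMarking J a A) (m' : SiegelAdelicMarking J' a' A')
    (q : Matrix (Fin g ⊕ Fin g) (Fin g ⊕ Fin g) ℚ) (h : A ⟶ A')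
    (hh : ∀ v : Fin g ⊕ Fin g → ℚ, AlgPoints.map h.hom.hom.hom (m.r v) = m'.r (q *ᵥ v))
    {v : Fin g ⊕ Fin g → ℚ} (hv : v ∈ latticeOfGL (a : GL (Fin g ⊕ Fin g) finAdeleQ)) :
    q *ᵥ v ∈ latticeOfGL (a' : GL (Fin g ⊕ Fin g) finAdeleQ) := by
  rw [← m'.r_eq_one_iff_mem_latticeOfGL, ← hh, (m.r_eq_one_iff_mem_latticeOfGL v).2 hv, map_hom_one]

/-- (L′) the same as an inclusion of `ℤ`-submodules: `Λ_a ≤ q⁻¹Λ_{a′}`. [cite: Milne2005ShimuraVarieties, §6 Thm. 6.11 p. 74 and p. 75] -/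
theorem latticeOfGL_le_comap_of_forall_map_r_eq (m : SiegelAdelicMarking J a A) (m' : SiegelAdelicMarking J' a' A')
    (q : Matrix (Fin g ⊕ Fin g) (Fin g ⊕ Fin g) ℚ) (h : A ⟶ A')
    (hh : ∀ v : Fin g ⊕ Fin g → ℚ, AlgPoints.map h.hom.hom.hom (m.r v) = m'.r (q *ᵥ v)) :
    latticeOfGL (a : GL (Fin g ⊕ Fin g) finAdeleQ) ≤
      (latticeOfGL (a' : GL (Fin g ⊕ Fin g) finAdeleQ)).comap (q.mulVecLin.restrictScalars ℤ) := by
  intro v hv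
  rw [Submodule.mem_comap, LinearMap.restrictScalars_apply, Matrix.mulVecLin_apply]
  exact m.mulVec_mem_latticeOfGL_of_forall_map_r_eq m' q h hh hv

/-- **A homomorphism reading an INVERTIBLE rational matrix is an isogeny**: onto on `ℂ`-points (★ `surjective_map_of_forall_map_r_eq`), and both varieties have
dimension `g` (★ `dim_eq`), so ★ `isIsogeny_of_surjective_of_dim_eq` applies. [cite: Milne2005ShimuraVarieties, §6 Thm. 6.11 p. 74 and p. 75]
[cite: MumfordAV1970, §7 Thm. 4 (p. 72)] -/
theorem isIsogeny_of_forall_map_r_eq (m : SiegelAdelicMarking J a A) (m' : SiegelAdelicMarking J' a' A')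
    (q : GL (Fin g ⊕ Fin g) ℚ) (h : A ⟶ A')
    (hh : ∀ v : Fin g ⊕ Fin g → ℚ, AlgPoints.map h.hom.hom.hom (m.r v) =
      m'.r (((q : GL (Fin g ⊕ Fin g) ℚ) : Matrix (Fin g ⊕ Fin g) (Fin g ⊕ Fin g) ℚ) *ᵥ v)) :
    IsIsogeny h := by
  haveI : Surjective (AbelianVariety.Hom.toSchemeHom h) :=
    (AbelianVariety.surjective_toSchemeHom_iff_map_surjective h).2 (m.surjective_map_of_forall_map_r_eq m' q h hh)
  exact AbelianVariety.isIsogeny_of_surjective_of_dim_eq h (m.dim_eq.trans m'.dim_eq.symm)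

/-- (K) **KERNEL LAW**: for `h` reading an invertible `q`, `h P = 1 ↔ P = u v` for some `v ∈ V` with `q v ∈ Λ_{a′}` — a point killed by the isogeny `h` is
torsion, hence a `u v` (★ `exists_r_eq_of_isIsogeny_of_map_eq_one`), and `h (u v) = u′ (q v) = 1 ↔ q v ∈ Λ_{a′}` (★ `r_eq_one_iff_mem_latticeOfGL`).
[cite: Milne2005ShimuraVarieties, §6 Thm. 6.11 p. 74 and p. 75] [cite: MumfordAV1970, §7 Thm. 4 (p. 72)] -/
theorem map_eq_one_iff_of_forall_map_r_eq (m : SiegelAdelicMarking J a A) (m' : SiegelAdelicMarking J' a' A')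
    (q : GL (Fin g ⊕ Fin g) ℚ) (h : A ⟶ A')
    (hh : ∀ v : Fin g ⊕ Fin g → ℚ, AlgPoints.map h.hom.hom.hom (m.r v) =
      m'.r (((q : GL (Fin g ⊕ Fin g) ℚ) : Matrix (Fin g ⊕ Fin g) (Fin g ⊕ Fin g) ℚ) *ᵥ v))
    (P : A.Points ℂ) :
    AlgPoints.map h.hom.hom.hom P = 1 ↔
      ∃ v : Fin g ⊕ Fin g → ℚ, m.r v = P ∧
        ((q : GL (Fin g ⊕ Fin g) ℚ) : Matrix (Fin g ⊕ Fin g) (Fin g ⊕ Fin g) ℚ) *ᵥ v ∈ latticeOfGL (a' : GL (Fin g ⊕ Fin g) finAdeleQ) := by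
  constructor
  · intro hP
    obtain ⟨v, rfl⟩ := m.exists_r_eq_of_isIsogeny_of_map_eq_one (m.isIsogeny_of_forall_map_r_eq m' q h hh) hP
    rw [hh, m'.r_eq_one_iff_mem_latticeOfGL] at hP
    exact ⟨v, rfl, hP⟩
  · rintro ⟨v, rfl, hv⟩
    rw [hh, m'.r_eq_one_iff_mem_latticeOfGL]
    exact hv

/-- (K, subgroup form) **`Ker h (ℂ) = u (q⁻¹Λ_{a′})`** as subsets of `A(ℂ)` (★ `AbelianVariety.Hom.kerPoints`, the `K : Subgroup` currency of the E-side roofs).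
[cite: Milne2005ShimuraVarieties, §6 Thm. 6.11 p. 74 and p. 75] [cite: MumfordAV1970, §7 Thm. 4 (p. 72)] -/
theorem coe_kerPoints_eq_image_r (m : SiegelAdelicMarking J a A) (m' : SiegelAdelicMarking J' a' A')
    (q : GL (Fin g ⊕ Fin g) ℚ) (h : A ⟶ A')
    (hh : ∀ v : Fin g ⊕ Fin g → ℚ, AlgPoints.map h.hom.hom.hom (m.r v) =
      m'.r (((q : GL (Fin g ⊕ Fin g) ℚ) : Matrix (Fin g ⊕ Fin g) (Fin g ⊕ Fin g) ℚ) *ᵥ v)) :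
    (kerPoints (specOver ℂ ℂ) h : Set (A.Points ℂ)) =
      m.r '' ((latticeOfGL (a' : GL (Fin g ⊕ Fin g) finAdeleQ)).comap
        ((((q : GL (Fin g ⊕ Fin g) ℚ) : Matrix (Fin g ⊕ Fin g) (Fin g ⊕ Fin g) ℚ).mulVecLin).restrictScalars ℤ) :
          Set (Fin g ⊕ Fin g → ℚ)) := by
  ext P
  rw [SetLike.mem_coe, mem_kerPoints_iff, Set.mem_image, ← AlgPoints.map_apply, m.map_eq_one_iff_of_forall_map_r_eq m' q h hh P]
  refine exists_congr fun v => ?_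
  rw [SetLike.mem_coe, Submodule.mem_comap, LinearMap.restrictScalars_apply, Matrix.mulVecLin_apply]
  exact and_comm

/-- (C) **KERNEL COUNT `Nat.card (Ker h (ℂ)) = [q⁻¹Λ_{a′} : Λ_a]`** (the relative index of `Λ_a` in `q⁻¹Λ_{a′}`; `Λ_a ≤ q⁻¹Λ_{a′}` by (L′)).
[cite: Milne2005ShimuraVarieties, §6 Thm. 6.11 p. 74 and p. 75] [cite: MumfordAV1970, §7 Thm. 4 (p. 72)] -/
theorem natCard_kerPoints_eq_relIndex (m : SiegelAdelicMarking J a A) (m' : SiegelAdelicMarking J' a' A')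
    (q : GL (Fin g ⊕ Fin g) ℚ) (h : A ⟶ A')
    (hh : ∀ v : Fin g ⊕ Fin g → ℚ, AlgPoints.map h.hom.hom.hom (m.r v) =
      m'.r (((q : GL (Fin g ⊕ Fin g) ℚ) : Matrix (Fin g ⊕ Fin g) (Fin g ⊕ Fin g) ℚ) *ᵥ v)) :
    Nat.card ↥(kerPoints (specOver ℂ ℂ) h) =
      (latticeOfGL (a : GL (Fin g ⊕ Fin g) finAdeleQ)).toAddSubgroup.relIndex
        ((latticeOfGL (a' : GL (Fin g ⊕ Fin g) finAdeleQ)).comap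
          ((((q : GL (Fin g ⊕ Fin g) ℚ) : Matrix (Fin g ⊕ Fin g) (Fin g ⊕ Fin g) ℚ).mulVecLin).restrictScalars ℤ)).toAddSubgroup := by
  rw [← m.natCard_image_r_eq_relIndex]
  exact Nat.card_congr (Equiv.setCongr (m.coe_kerPoints_eq_image_r m' q h hh))

/-! ### §3 (U) Readings compose, and determine the homomorphism -/

/-- **A composite of readings reads the product matrix**: `h (u v) = u′ (q v)` and `h′ (u′ w) = u″ (q′ w)` give `(h ≫ h′) (u v) = u″ (q′ q v)`.
[cite: Milne2005ShimuraVarieties, §6 Thm. 6.11 p. 74] -/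
theorem forall_map_comp_r_eq (m : SiegelAdelicMarking J a A) (m' : SiegelAdelicMarking J' a' A') (m'' : SiegelAdelicMarking J'' a'' A'')
    (q q' : Matrix (Fin g ⊕ Fin g) (Fin g ⊕ Fin g) ℚ) (h : A ⟶ A') (h' : A' ⟶ A'')
    (hh : ∀ v : Fin g ⊕ Fin g → ℚ, AlgPoints.map h.hom.hom.hom (m.r v) = m'.r (q *ᵥ v))
    (hh' : ∀ w : Fin g ⊕ Fin g → ℚ, AlgPoints.map h'.hom.hom.hom (m'.r w) = m''.r (q' *ᵥ w)) :
    ∀ v : Fin g ⊕ Fin g → ℚ, AlgPoints.map (h ≫ h').hom.hom.hom (m.r v) = m''.r ((q' * q) *ᵥ v) := by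
  intro v
  rw [AbelianVariety.map_hom_comp, hh, hh', Matrix.mulVec_mulVec]

/-- The identity reads the identity matrix. [cite: Milne2005ShimuraVarieties, §6 Thm. 6.11 p. 74] -/
theorem forall_map_id_r_eq (m : SiegelAdelicMarking J a A) :
    ∀ v : Fin g ⊕ Fin g → ℚ, AlgPoints.map (𝟙 A : A ⟶ A).hom.hom.hom (m.r v) =
      m.r ((1 : Matrix (Fin g ⊕ Fin g) (Fin g ⊕ Fin g) ℚ) *ᵥ v) := by
  intro v
  rw [AbelianVariety.map_hom_id, Matrix.one_mulVec]

/-- **Two homomorphisms out of a marked `A` reading the same matrix are equal** (★ `hom_eq_of_forall_map_r_eq`: determined on `u(V) = A(ℂ)_tors`).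
[cite: MumfordAV1970, §19 Thm. 3 and Cor. 1] [cite: Milne2005ShimuraVarieties, §6 Thm. 6.11 p. 74] -/
theorem eq_of_forall_map_r_eq (m : SiegelAdelicMarking J a A) (m' : SiegelAdelicMarking J' a' A')
    (q : Matrix (Fin g ⊕ Fin g) (Fin g ⊕ Fin g) ℚ) (h₁ h₂ : A ⟶ A')
    (hh₁ : ∀ v : Fin g ⊕ Fin g → ℚ, AlgPoints.map h₁.hom.hom.hom (m.r v) = m'.r (q *ᵥ v))
    (hh₂ : ∀ v : Fin g ⊕ Fin g → ℚ, AlgPoints.map h₂.hom.hom.hom (m.r v) = m'.r (q *ᵥ v)) :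
    h₁ = h₂ := by
  exact m.hom_eq_of_forall_map_r_eq h₁ h₂ fun v => by rw [hh₁, hh₂]

/-- **Squares of readings commute when the matrices do**: if `h₁`, `h₂`, `h₃`, `h₄` read `q₁`, `q₂`, `q₃`, `q₄` (through markings `m → m₁ → m″` and
`m → m₂ → m″`) and `q₂ q₁ = q₄ q₃`, then `h₁ ≫ h₂ = h₃ ≫ h₄` — e.g. the `𝒪_F`-equivariance clause (r4) of a roof from `M(a) q = q M′(a)`.
[cite: MumfordAV1970, §19 Thm. 3 and Cor. 1] [cite: Milne2005ShimuraVarieties, §6 Thm. 6.11 p. 74] -/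
theorem comp_eq_comp_of_mul_eq_mul (m : SiegelAdelicMarking J a A) {A₁ A₂ : AbelianVariety ℂ} {J₁ J₂ : C0pm δ} {a₁ a₂ : gspFinAdelic δ}
    (m₁ : SiegelAdelicMarking J₁ a₁ A₁) (m₂ : SiegelAdelicMarking J₂ a₂ A₂) (m'' : SiegelAdelicMarking J'' a'' A'')
    (q₁ q₂ q₃ q₄ : Matrix (Fin g ⊕ Fin g) (Fin g ⊕ Fin g) ℚ) (h₁ : A ⟶ A₁) (h₂ : A₁ ⟶ A'') (h₃ : A ⟶ A₂) (h₄ : A₂ ⟶ A'')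
    (hh₁ : ∀ v : Fin g ⊕ Fin g → ℚ, AlgPoints.map h₁.hom.hom.hom (m.r v) = m₁.r (q₁ *ᵥ v))
    (hh₂ : ∀ w : Fin g ⊕ Fin g → ℚ, AlgPoints.map h₂.hom.hom.hom (m₁.r w) = m''.r (q₂ *ᵥ w))
    (hh₃ : ∀ v : Fin g ⊕ Fin g → ℚ, AlgPoints.map h₃.hom.hom.hom (m.r v) = m₂.r (q₃ *ᵥ v))
    (hh₄ : ∀ w : Fin g ⊕ Fin g → ℚ, AlgPoints.map h₄.hom.hom.hom (m₂.r w) = m''.r (q₄ *ᵥ w))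
    (hq : q₂ * q₁ = q₄ * q₃) :
    h₁ ≫ h₂ = h₃ ≫ h₄ := by
  refine m.hom_eq_of_forall_map_r_eq _ _ fun v => ?_
  rw [m.forall_map_comp_r_eq m₁ m'' q₁ q₂ h₁ h₂ hh₁ hh₂ v, m.forall_map_comp_r_eq m₂ m'' q₃ q₄ h₃ h₄ hh₃ hh₄ v, hq]

/-! ### §4 (T) Kernel meets ideal torsion: `Ker h ∩ A[𝔞]` read on the lattice side -/

/-- (T) **`h P = 1 ∧ (∀ b ∈ 𝔞, ι b P = 1) ↔ ∃ v, u v = P ∧ q v ∈ Λ_{a′} ∧ ∀ b ∈ 𝔞, M b v ∈ Λ_a`** for a family of endomorphisms `ι b` (`b ∈ 𝔞`) reading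
rational matrices `M b` on the marking `m` (`ι b (u v) = u (M b v)`): the `K_β ∩ A[𝔭]` clause of the E-side Hecke roofs, lattice side
(`P = u v` by (K); then `ι b (u v) = u (M b v) = 1 ↔ M b v ∈ Λ_a`). [cite: Milne2005ShimuraVarieties, §6 Thm. 6.11 p. 74 and p. 75]
[cite: MumfordAV1970, §7 Thm. 4 (p. 72)] -/
theorem map_eq_one_and_forall_iff (m : SiegelAdelicMarking J a A) (m' : SiegelAdelicMarking J' a' A')
    (q : GL (Fin g ⊕ Fin g) ℚ) (h : A ⟶ A')
    (hh : ∀ v : Fin g ⊕ Fin g → ℚ, AlgPoints.map h.hom.hom.hom (m.r v) =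
      m'.r (((q : GL (Fin g ⊕ Fin g) ℚ) : Matrix (Fin g ⊕ Fin g) (Fin g ⊕ Fin g) ℚ) *ᵥ v))
    {R : Type*} (𝔞 : Set R) (ι : R → (A ⟶ A)) (M : R → Matrix (Fin g ⊕ Fin g) (Fin g ⊕ Fin g) ℚ)
    (hι : ∀ b ∈ 𝔞, ∀ v : Fin g ⊕ Fin g → ℚ, AlgPoints.map (ι b).hom.hom.hom (m.r v) = m.r (M b *ᵥ v))
    (P : A.Points ℂ) :
    (AlgPoints.map h.hom.hom.hom P = 1 ∧ ∀ b ∈ 𝔞, AlgPoints.map (ι b).hom.hom.hom P = 1) ↔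
      ∃ v : Fin g ⊕ Fin g → ℚ, m.r v = P ∧
        ((q : GL (Fin g ⊕ Fin g) ℚ) : Matrix (Fin g ⊕ Fin g) (Fin g ⊕ Fin g) ℚ) *ᵥ v ∈ latticeOfGL (a' : GL (Fin g ⊕ Fin g) finAdeleQ) ∧
          ∀ b ∈ 𝔞, M b *ᵥ v ∈ latticeOfGL (a : GL (Fin g ⊕ Fin g) finAdeleQ) := by
  constructor
  · rintro ⟨hP, hι'⟩
    obtain ⟨v, rfl, hv⟩ := (m.map_eq_one_iff_of_forall_map_r_eq m' q h hh _).1 hP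
    refine ⟨v, rfl, hv, fun b hb => ?_⟩
    have hb' := hι' b hb
    rwa [hι b hb, m.r_eq_one_iff_mem_latticeOfGL] at hb'
  · rintro ⟨v, rfl, hv, hM⟩
    refine ⟨(m.map_eq_one_iff_of_forall_map_r_eq m' q h hh _).2 ⟨v, rfl, hv⟩, fun b hb => ?_⟩
    rw [hι b hb, m.r_eq_one_iff_mem_latticeOfGL]
    exact hM b hb

/-- (T, subgroup form) **`Ker h (ℂ) ∩ A[𝔞] = u (q⁻¹Λ_{a′} ⊓ ⨅_{b ∈ 𝔞} (M b)⁻¹Λ_a)`** as subsets of `A(ℂ)`.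
[cite: Milne2005ShimuraVarieties, §6 Thm. 6.11 p. 74 and p. 75] [cite: MumfordAV1970, §7 Thm. 4 (p. 72)] -/
theorem setOf_map_eq_one_and_forall_eq_image_r (m : SiegelAdelicMarking J a A) (m' : SiegelAdelicMarking J' a' A')
    (q : GL (Fin g ⊕ Fin g) ℚ) (h : A ⟶ A')
    (hh : ∀ v : Fin g ⊕ Fin g → ℚ, AlgPoints.map h.hom.hom.hom (m.r v) =
      m'.r (((q : GL (Fin g ⊕ Fin g) ℚ) : Matrix (Fin g ⊕ Fin g) (Fin g ⊕ Fin g) ℚ) *ᵥ v))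
    {R : Type*} (𝔞 : Set R) (ι : R → (A ⟶ A)) (M : R → Matrix (Fin g ⊕ Fin g) (Fin g ⊕ Fin g) ℚ)
    (hι : ∀ b ∈ 𝔞, ∀ v : Fin g ⊕ Fin g → ℚ, AlgPoints.map (ι b).hom.hom.hom (m.r v) = m.r (M b *ᵥ v)) :
    {P : A.Points ℂ | AlgPoints.map h.hom.hom.hom P = 1 ∧ ∀ b ∈ 𝔞, AlgPoints.map (ι b).hom.hom.hom P = 1} =
      m.r '' (((latticeOfGL (a' : GL (Fin g ⊕ Fin g) finAdeleQ)).comap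
            ((((q : GL (Fin g ⊕ Fin g) ℚ) : Matrix (Fin g ⊕ Fin g) (Fin g ⊕ Fin g) ℚ).mulVecLin).restrictScalars ℤ) ⊓
          ⨅ b ∈ 𝔞, (latticeOfGL (a : GL (Fin g ⊕ Fin g) finAdeleQ)).comap ((M b).mulVecLin.restrictScalars ℤ) :
            Submodule ℤ (Fin g ⊕ Fin g → ℚ)) : Set (Fin g ⊕ Fin g → ℚ)) := by
  ext P
  rw [Set.mem_setOf_eq, m.map_eq_one_and_forall_iff m' q h hh 𝔞 ι M hι P, Set.mem_image]
  refine exists_congr fun v => ?_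
  simp only [SetLike.mem_coe, Submodule.mem_inf, Submodule.mem_comap, Submodule.mem_iInf, LinearMap.restrictScalars_apply,
    Matrix.mulVecLin_apply]
  constructor
  · rintro ⟨hP, hv, hM⟩
    exact ⟨⟨hv, fun b hb => hM b hb⟩, hP⟩
  · rintro ⟨⟨hv, hM⟩, hP⟩
    exact ⟨hP, hv, fun b hb => hM b hb⟩

/-- (T, count) **`Nat.card (Ker h (ℂ) ∩ A[𝔞]) = [q⁻¹Λ_{a′} ⊓ ⨅_{b ∈ 𝔞} (M b)⁻¹Λ_a : Λ_a]`** (relative index; the `Nat.card H_β = p^f` clause of the E-side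
Hecke roofs is this number computed on the lattice side). [cite: Milne2005ShimuraVarieties, §6 Thm. 6.11 p. 74 and p. 75] [cite: MumfordAV1970, §7 Thm. 4 (p. 72)] -/
theorem natCard_map_eq_one_and_forall_eq_relIndex (m : SiegelAdelicMarking J a A) (m' : SiegelAdelicMarking J' a' A')
    (q : GL (Fin g ⊕ Fin g) ℚ) (h : A ⟶ A')
    (hh : ∀ v : Fin g ⊕ Fin g → ℚ, AlgPoints.map h.hom.hom.hom (m.r v) =
      m'.r (((q : GL (Fin g ⊕ Fin g) ℚ) : Matrix (Fin g ⊕ Fin g) (Fin g ⊕ Fin g) ℚ) *ᵥ v))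
    {R : Type*} (𝔞 : Set R) (ι : R → (A ⟶ A)) (M : R → Matrix (Fin g ⊕ Fin g) (Fin g ⊕ Fin g) ℚ)
    (hι : ∀ b ∈ 𝔞, ∀ v : Fin g ⊕ Fin g → ℚ, AlgPoints.map (ι b).hom.hom.hom (m.r v) = m.r (M b *ᵥ v)) :
    Nat.card {P : A.Points ℂ // AlgPoints.map h.hom.hom.hom P = 1 ∧ ∀ b ∈ 𝔞, AlgPoints.map (ι b).hom.hom.hom P = 1} =
      (latticeOfGL (a : GL (Fin g ⊕ Fin g) finAdeleQ)).toAddSubgroup.relIndex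
        ((latticeOfGL (a' : GL (Fin g ⊕ Fin g) finAdeleQ)).comap
            ((((q : GL (Fin g ⊕ Fin g) ℚ) : Matrix (Fin g ⊕ Fin g) (Fin g ⊕ Fin g) ℚ).mulVecLin).restrictScalars ℤ) ⊓
          ⨅ b ∈ 𝔞, (latticeOfGL (a : GL (Fin g ⊕ Fin g) finAdeleQ)).comap ((M b).mulVecLin.restrictScalars ℤ) :
            Submodule ℤ (Fin g ⊕ Fin g → ℚ)).toAddSubgroup := by
  rw [← m.natCard_image_r_eq_relIndex, ← m.setOf_map_eq_one_and_forall_eq_image_r m' q h hh 𝔞 ι M hι]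
  rfl

/-! ### §5 (ED. 2, add-only) FAMILIES of readings: `⋂_{i ∈ S} Ker h_i ∩ A[𝔞]` on the lattice side (roof clause (r1) with `K := {P | ∀ π ∈ 𝔭_w, h_π P = 1}`) -/

/-- (K-family) **`(∀ i ∈ S, h_i P = 1) ∧ (∀ b ∈ 𝔞, ι b P = 1) ↔ ∃ v, u v = P ∧ (∀ i ∈ S, q_i v ∈ Λ_{a′}) ∧ ∀ b ∈ 𝔞, M b v ∈ Λ_a`** for a family of
homomorphisms `h_i : A ⟶ A′` (`i ∈ S`) reading rational matrices `q_i` (w.r.t. `m`, `m′`) ONE of which (`i₀ ∈ S`) is invertible, and endomorphisms `ι b` (`b ∈ 𝔞`)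
reading `M b` on `m` (`P = u v` by (K) for `h_{i₀}`; «invertible over `ℚ`» is all that is asked of `q_{i₀}` — for the `𝔭_w`-family `h_π` of an `𝒪_F`-action
ANY `π₀ ≠ 0` in `𝔭_w` qualifies, its matrix on `V` being that of a nonzero field element). [cite: Milne2005ShimuraVarieties, §6 Thm. 6.11 p. 74 and p. 75]
[cite: MumfordAV1970, §7 Thm. 4 (p. 72)] -/
theorem forall_map_eq_one_and_forall_iff (m : SiegelAdelicMarking J a A) (m' : SiegelAdelicMarking J' a' A')
    {R : Type*} (S : Set R) (h : R → (A ⟶ A')) (q : R → Matrix (Fin g ⊕ Fin g) (Fin g ⊕ Fin g) ℚ)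
    (hh : ∀ i ∈ S, ∀ v : Fin g ⊕ Fin g → ℚ, AlgPoints.map (h i).hom.hom.hom (m.r v) = m'.r (q i *ᵥ v))
    {i₀ : R} (hi₀ : i₀ ∈ S) (q₀ : GL (Fin g ⊕ Fin g) ℚ)
    (hq₀ : ((q₀ : GL (Fin g ⊕ Fin g) ℚ) : Matrix (Fin g ⊕ Fin g) (Fin g ⊕ Fin g) ℚ) = q i₀)
    {R' : Type*} (𝔞 : Set R') (ι : R' → (A ⟶ A)) (M : R' → Matrix (Fin g ⊕ Fin g) (Fin g ⊕ Fin g) ℚ)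
    (hι : ∀ b ∈ 𝔞, ∀ v : Fin g ⊕ Fin g → ℚ, AlgPoints.map (ι b).hom.hom.hom (m.r v) = m.r (M b *ᵥ v))
    (P : A.Points ℂ) :
    ((∀ i ∈ S, AlgPoints.map (h i).hom.hom.hom P = 1) ∧ ∀ b ∈ 𝔞, AlgPoints.map (ι b).hom.hom.hom P = 1) ↔
      ∃ v : Fin g ⊕ Fin g → ℚ, m.r v = P ∧
        (∀ i ∈ S, q i *ᵥ v ∈ latticeOfGL (a' : GL (Fin g ⊕ Fin g) finAdeleQ)) ∧
          ∀ b ∈ 𝔞, M b *ᵥ v ∈ latticeOfGL (a : GL (Fin g ⊕ Fin g) finAdeleQ) := by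
  have hh₀ : ∀ v : Fin g ⊕ Fin g → ℚ, AlgPoints.map (h i₀).hom.hom.hom (m.r v) =
      m'.r (((q₀ : GL (Fin g ⊕ Fin g) ℚ) : Matrix (Fin g ⊕ Fin g) (Fin g ⊕ Fin g) ℚ) *ᵥ v) := fun v => by
    rw [hh i₀ hi₀ v, hq₀]
  constructor
  · rintro ⟨hP, hι'⟩
    obtain ⟨v, rfl, -⟩ := (m.map_eq_one_iff_of_forall_map_r_eq m' q₀ (h i₀) hh₀ _).1 (hP i₀ hi₀)
    refine ⟨v, rfl, fun i hi => ?_, fun b hb => ?_⟩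
    · have hi' := hP i hi
      rwa [hh i hi, m'.r_eq_one_iff_mem_latticeOfGL] at hi'
    · have hb' := hι' b hb
      rwa [hι b hb, m.r_eq_one_iff_mem_latticeOfGL] at hb'
  · rintro ⟨v, rfl, hv, hM⟩
    refine ⟨fun i hi => ?_, fun b hb => ?_⟩
    · rw [hh i hi, m'.r_eq_one_iff_mem_latticeOfGL]
      exact hv i hi
    · rw [hι b hb, m.r_eq_one_iff_mem_latticeOfGL]
      exact hM b hb

/-- (K-family, subgroup form) **`⋂_{i ∈ S} Ker h_i (ℂ) ∩ A[𝔞] = u ((⨅_{i ∈ S} q_i⁻¹Λ_{a′}) ⊓ ⨅_{b ∈ 𝔞} (M b)⁻¹Λ_a)`** in `A(ℂ)`. [cite: Milne2005ShimuraVarieties, §6 Thm. 6.11 p. 74 and p. 75] -/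
theorem setOf_forall_map_eq_one_and_forall_eq_image_r (m : SiegelAdelicMarking J a A) (m' : SiegelAdelicMarking J' a' A')
    {R : Type*} (S : Set R) (h : R → (A ⟶ A')) (q : R → Matrix (Fin g ⊕ Fin g) (Fin g ⊕ Fin g) ℚ)
    (hh : ∀ i ∈ S, ∀ v : Fin g ⊕ Fin g → ℚ, AlgPoints.map (h i).hom.hom.hom (m.r v) = m'.r (q i *ᵥ v))
    {i₀ : R} (hi₀ : i₀ ∈ S) (q₀ : GL (Fin g ⊕ Fin g) ℚ)
    (hq₀ : ((q₀ : GL (Fin g ⊕ Fin g) ℚ) : Matrix (Fin g ⊕ Fin g) (Fin g ⊕ Fin g) ℚ) = q i₀)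
    {R' : Type*} (𝔞 : Set R') (ι : R' → (A ⟶ A)) (M : R' → Matrix (Fin g ⊕ Fin g) (Fin g ⊕ Fin g) ℚ)
    (hι : ∀ b ∈ 𝔞, ∀ v : Fin g ⊕ Fin g → ℚ, AlgPoints.map (ι b).hom.hom.hom (m.r v) = m.r (M b *ᵥ v)) :
    {P : A.Points ℂ | (∀ i ∈ S, AlgPoints.map (h i).hom.hom.hom P = 1) ∧ ∀ b ∈ 𝔞, AlgPoints.map (ι b).hom.hom.hom P = 1} =
      m.r '' (((⨅ i ∈ S, (latticeOfGL (a' : GL (Fin g ⊕ Fin g) finAdeleQ)).comap ((q i).mulVecLin.restrictScalars ℤ)) ⊓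
          ⨅ b ∈ 𝔞, (latticeOfGL (a : GL (Fin g ⊕ Fin g) finAdeleQ)).comap ((M b).mulVecLin.restrictScalars ℤ) :
            Submodule ℤ (Fin g ⊕ Fin g → ℚ)) : Set (Fin g ⊕ Fin g → ℚ)) := by
  ext P
  rw [Set.mem_setOf_eq, m.forall_map_eq_one_and_forall_iff m' S h q hh hi₀ q₀ hq₀ 𝔞 ι M hι P, Set.mem_image]
  refine exists_congr fun v => ?_
  simp only [SetLike.mem_coe, Submodule.mem_inf, Submodule.mem_comap, Submodule.mem_iInf, LinearMap.restrictScalars_apply,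
    Matrix.mulVecLin_apply]
  constructor
  · rintro ⟨hP, hv, hM⟩
    exact ⟨⟨fun i hi => hv i hi, fun b hb => hM b hb⟩, hP⟩
  · rintro ⟨⟨hv, hM⟩, hP⟩
    exact ⟨hP, fun i hi => hv i hi, fun b hb => hM b hb⟩

/-- (K-family, count) **`Nat.card (⋂_{i ∈ S} Ker h_i (ℂ) ∩ A[𝔞]) = [(⨅_{i ∈ S} q_i⁻¹Λ_{a′}) ⊓ ⨅_{b ∈ 𝔞} (M b)⁻¹Λ_a : Λ_a]`** (relative index) — the
`Nat.card H_β = p^f` clause of the E-side Hecke roofs, lattice side. [cite: Milne2005ShimuraVarieties, §6 Thm. 6.11 p. 74 and p. 75] [cite: MumfordAV1970, §7 Thm. 4 (p. 72)] -/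
theorem natCard_forall_map_eq_one_and_forall_eq_relIndex (m : SiegelAdelicMarking J a A) (m' : SiegelAdelicMarking J' a' A')
    {R : Type*} (S : Set R) (h : R → (A ⟶ A')) (q : R → Matrix (Fin g ⊕ Fin g) (Fin g ⊕ Fin g) ℚ)
    (hh : ∀ i ∈ S, ∀ v : Fin g ⊕ Fin g → ℚ, AlgPoints.map (h i).hom.hom.hom (m.r v) = m'.r (q i *ᵥ v))
    {i₀ : R} (hi₀ : i₀ ∈ S) (q₀ : GL (Fin g ⊕ Fin g) ℚ)
    (hq₀ : ((q₀ : GL (Fin g ⊕ Fin g) ℚ) : Matrix (Fin g ⊕ Fin g) (Fin g ⊕ Fin g) ℚ) = q i₀)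
    {R' : Type*} (𝔞 : Set R') (ι : R' → (A ⟶ A)) (M : R' → Matrix (Fin g ⊕ Fin g) (Fin g ⊕ Fin g) ℚ)
    (hι : ∀ b ∈ 𝔞, ∀ v : Fin g ⊕ Fin g → ℚ, AlgPoints.map (ι b).hom.hom.hom (m.r v) = m.r (M b *ᵥ v)) :
    Nat.card {P : A.Points ℂ // (∀ i ∈ S, AlgPoints.map (h i).hom.hom.hom P = 1) ∧ ∀ b ∈ 𝔞, AlgPoints.map (ι b).hom.hom.hom P = 1} =
      (latticeOfGL (a : GL (Fin g ⊕ Fin g) finAdeleQ)).toAddSubgroup.relIndex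
        ((⨅ i ∈ S, (latticeOfGL (a' : GL (Fin g ⊕ Fin g) finAdeleQ)).comap ((q i).mulVecLin.restrictScalars ℤ)) ⊓
          ⨅ b ∈ 𝔞, (latticeOfGL (a : GL (Fin g ⊕ Fin g) finAdeleQ)).comap ((M b).mulVecLin.restrictScalars ℤ) :
            Submodule ℤ (Fin g ⊕ Fin g → ℚ)).toAddSubgroup := by
  rw [← m.natCard_image_r_eq_relIndex, ← m.setOf_forall_map_eq_one_and_forall_eq_image_r m' S h q hh hi₀ q₀ hq₀ 𝔞 ι M hι]
  rfl

end SiegelAdelicMarking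

end Literature.AlgebraicGeometry.ModuliOfAbelianVarieties

end
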